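import Mathlib
import HarnessLib
import HarnessLib.Audit
import Summits.Schanuel.Statement
import HarnessLib.Audit.Status.Attr

/-!
Route: SheetDescent

DORMANT since 2026-08-22T18:46:10Z (reconciler: no traction for 5.6 d (last activity item-evidence-added at 2026-08-17T04:24:25Z); parked, not closed — `ledger route dormant route-Schanuel-SheetDescent --off` to reactivate) — unstaffed, not closed; items shared with open routes are served there. `ledger route dormant <id> --off` reactivates.

# Route SheetDescent — sheet deformations — moving counterexamples descend in rank by Ax, so
Schanuel = no sliding and no transcendentally placed first counterexample; BNZ makes the latter
polylog-sparse

DEFORM, THEN COUNT. A first counterexample to Schanuel is a ℚ-linearly independent x ∈ ℂⁿ with trdeg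
ℚ(x, eˣ) < n while Schanuel
holds in every rank r < n; P₀ = (x, eˣ) is the generic point of its ℚ-locus Λₓ (dim < n). A SHEET
DEFORMATION of x is a pair
(a, ξ): a real-ALGEBRAIC sheet path a(s) ∈ ℝⁿ and an analytic witness path ξ(s) ∈ ℂⁿ on (0, ε), (a,
ξ)(0⁺) = (0, x), with
P(s) = (ξ(s) + 2πi a(s), e^(ξ(s))) ∈ Λₓ — the points of the real-translated graphs Γ + (2πi a, 0)
which the card's sheet set T_V
parametrises (a ∈ ℤⁿ = the other sheets of genuine graph points). It is MOVING if every
ℤ-combination q·ξ that is constant along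
the path has q·a constant, SLIDING otherwise (a frozen witness-combination whose sheet combination
moves: Λₓ is ruled through P₀ by a
translate of a real-algebraic arc in the x-direction at fixed y^q). It suffices to show X =
SlidingRigidity ∧ TransPartRigidity:
(L) a first counterexample admits no sliding deformation; (Z) a first counterexample is never
TRANSCENDENTALLY PLACED — it admits a
moving or a sliding deformation (it lies in the algebraic part of its sheet family, not on an
isolated sheet or a transcendental arc
of sheets). The third class is settled by the route's engine MovingDescent (M, provable now from Ax
1971 in tree): a moving
deformation of a first counterexample is impossible — its frozen block descends to Schanuel in rank
n − r and its moving block then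
violates Ax–Schanuel by exactly one transcendence degree. Realises card
sparse-sheets-wilkie-counting in deciding form and CORRECTS
it: the algebraic part T_V^alg of the sheet set is not "lower-rank Schanuel" but moving (= lower
rank, proved) ∪ sliding (rank n,
Baker-type: at n = 2 exactly two ℚ-independent arguments of unimodular algebraic numbers on a
ℚ̄-curve, support
SlidingTwoUnimodular), while Wilkie's conjecture (BNZ 2022) makes the transcendentally placed graph
points of any fixed variety
polylog-sparse in the imaginary height (support TransPartSparse, the card's unconditional theorem in
point form).
Lean: `(∀ (n : ℕ), (∀ r < n, ∀ y : Fin r → ℂ, LinearIndependent ℚ y → (r : Cardinal) ≤ Algebra.trdeg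
ℚ ↥(IntermediateField.adjoin ℚ (Set.range y ∪ Set.range (Complex.exp ∘ y)))) → ∀ x : Fin n → ℂ,
LinearIndependent ℚ x → Algebra.trdeg ℚ ↥(IntermediateField.adjoin ℚ (Set.range x ∪ Set.range
(Complex.exp ∘ x))) < (n : Cardinal) → ¬ (∃ (a : ℝ → Fin n → ℝ) (ξ : ℝ → Fin n → ℂ) (ε : ℝ), (0 < ε
∧ a 0 = 0 ∧ ξ 0 = x ∧ ContinuousWithinAt a (Set.Ici 0) 0 ∧ ContinuousWithinAt ξ (Set.Ici 0) 0 ∧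
AnalyticOnNhd ℝ a (Set.Ioo 0 ε) ∧ AnalyticOnNhd ℝ ξ (Set.Ioo 0 ε) ∧ (∀ i, ∃ p : MvPolynomial (Fin 2)
ℝ, p ≠ 0 ∧ ∀ s ∈ Set.Ioo 0 ε, MvPolynomial.eval ![s, a s i] p = 0) ∧ (∀ s ∈ Set.Ioo 0 ε, ∀ f :
MvPolynomial (Fin n ⊕ Fin n) ℚ, MvPolynomial.aeval (Sum.elim x (Complex.exp ∘ x)) f = 0 →
MvPolynomial.aeval (Sum.elim (fun i => ξ s i + 2 * (Real.pi : ℂ) * Complex.I * ((a s i : ℝ) : ℂ))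
(fun i => Complex.exp (ξ s i))) f = 0)) ∧ (∃ q : Fin n → ℤ, (∃ c : ℂ, ∀ s ∈ Set.Ioo 0 ε, ∑ i, (q i :
ℂ) * ξ s i = c) ∧ ¬ (∃ c : ℝ, ∀ s ∈ Set.Ioo 0 ε, ∑ i, (q i : ℝ) * a s i = c)))) ∧ (∀ (n : ℕ), (∀ r <
n, ∀ y : Fin r → ℂ, LinearIndependent ℚ y → (r : Cardinal) ≤ Algebra.trdeg ℚ
↥(IntermediateField.adjoin ℚ (Set.range y ∪ Set.range (Complex.exp ∘ y)))) → ∀ x : Fin n → ℂ,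
LinearIndependent ℚ x → Algebra.trdeg ℚ ↥(IntermediateField.adjoin ℚ (Set.range x ∪ Set.range
(Complex.exp ∘ x))) < (n : Cardinal) → (∃ (a : ℝ → Fin n → ℝ) (ξ : ℝ → Fin n → ℂ) (ε : ℝ), (0 < ε ∧
a 0 = 0 ∧ ξ 0 = x ∧ ContinuousWithinAt a (Set.Ici 0) 0 ∧ ContinuousWithinAt ξ (Set.Ici 0) 0 ∧
AnalyticOnNhd ℝ a (Set.Ioo 0 ε) ∧ AnalyticOnNhd ℝ ξ (Set.Ioo 0 ε) ∧ (∀ i, ∃ p : MvPolynomial (Fin 2)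
ℝ, p ≠ 0 ∧ ∀ s ∈ Set.Ioo 0 ε, MvPolynomial.eval ![s, a s i] p = 0) ∧ (∀ s ∈ Set.Ioo 0 ε, ∀ f :
MvPolynomial (Fin n ⊕ Fin n) ℚ, MvPolynomial.aeval (Sum.elim x (Complex.exp ∘ x)) f = 0 →
MvPolynomial.aeval (Sum.elim (fun i => ξ s i + 2 * (Real.pi : ℂ) * Complex.I * ((a s i : ℝ) : ℂ))
(fun i => Complex.exp (ξ s i))) f = 0)) ∧ (∃ s ∈ Set.Ioo 0 ε, a s ≠ 0 ∨ ξ s ≠ x) ∧ (∀ q : Fin n → ℤ,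
(∃ c : ℂ, ∀ s ∈ Set.Ioo 0 ε, ∑ i, (q i : ℂ) * ξ s i = c) → (∃ c : ℝ, ∀ s ∈ Set.Ioo 0 ε, ∑ i, (q i :
ℝ) * a s i = c))) ∨ (∃ (a : ℝ → Fin n → ℝ) (ξ : ℝ → Fin n → ℂ) (ε : ℝ), (0 < ε ∧ a 0 = 0 ∧ ξ 0 = x ∧
ContinuousWithinAt a (Set.Ici 0) 0 ∧ ContinuousWithinAt ξ (Set.Ici 0) 0 ∧ AnalyticOnNhd ℝ a (Set.Ioo
0 ε) ∧ AnalyticOnNhd ℝ ξ (Set.Ioo 0 ε) ∧ (∀ i, ∃ p : MvPolynomial (Fin 2) ℝ, p ≠ 0 ∧ ∀ s ∈ Set.Ioo 0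
ε, MvPolynomial.eval ![s, a s i] p = 0) ∧ (∀ s ∈ Set.Ioo 0 ε, ∀ f : MvPolynomial (Fin n ⊕ Fin n) ℚ,
MvPolynomial.aeval (Sum.elim x (Complex.exp ∘ x)) f = 0 → MvPolynomial.aeval (Sum.elim (fun i => ξ s
i + 2 * (Real.pi : ℂ) * Complex.I * ((a s i : ℝ) : ℂ)) (fun i => Complex.exp (ξ s i))) f = 0)) ∧ (∃
q : Fin n → ℤ, (∃ c : ℂ, ∀ s ∈ Set.Ioo 0 ε, ∑ i, (q i : ℂ) * ξ s i = c) ∧ ¬ (∃ c : ℝ, ∀ s ∈ Set.Ioo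
0 ε, ∑ i, (q i : ℝ) * a s i = c))))`

## Assembly
Pure logic, kernel-checked (Sketch.lean / glue.lean, `closes`, axioms propext / Classical.choice /
Quot.sound): strong induction on
the rank n; given the induction hypothesis and a ℚ-independent z with trdeg < n, TransPartRigidity
yields a moving or a sliding
deformation, which MovingDescent resp. SlidingRigidity forbid; hence n ≤ trdeg, i.e. `Schanuel`
(which unfolds to ∀ n, SchanuelRank n
verbatim). The deciding theorem is `closes (hM : MovingDescent) (hL : SlidingRigidity) (hZ :
TransPartRigidity) : _root_.Schanuel`;
the two supports are not hypotheses.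

Rationale: WHY THIS LINE. Mechanism: instead of counting sheets first (the retired rung route SheetCounting
stopped at polylog sparsity, below the summit),
classify how a hypothetical first counterexample can MOVE in its sheet family {(a, x′) : (x′ + 2πi
a, e^(x′)) ∈ Λₓ} and let
functional transcendence act on the motion: along a deformation, Ax1971 (tree `ax_schanuel_holds`,
one derivation d/ds) bounds
trdeg_ℂ ℂ(ξ, e^ξ) below by r + 1 (r = rank of ξ modulo constants), while the specialisation ℚ[P₀] ↠
ℚ[P(·)] over the frozen field
F₀ = ℚ(u₀, e^(u₀)) (u₀ = the frozen ℤ-combinations of x, Schanuel in rank n − r < n) and the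
algebraicity of the sheet path bound it
above by r — so every MOVING configuration is lower-rank Schanuel plus Ax, with margin exactly zero,
and what remains of Schanuel is
the dichotomy SLIDING (ruled loci: the home of linear forms in logarithms — BakerTNT1975 kills the
line configurations, the curved
ones at n = 2 are the unitary-axis atom where ModulusFirst's UnitaryAxisFiniteness and RigidCore's
SparsityTwo (stmt-Schanuel-0971)
also land, DaquinoMacintyreTerzo2014) versus TRANSCENDENTALLY PLACED (isolated sheets and
transcendental arcs: e ⊥ π, log 2 ⊥ log 3,
π ⊥ log 2 all sit here), on which o-minimal point counting in its strongest form
(BinyaminiNovikovZak2024 = arXiv:2202.05305 Thm 1,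
Cor 1; PilaWilkie2006; Pila2022 Ch. 10) proves unconditional polylog sparsity and nothing more.
Imported areas: tame geometry /
Pfaffian point counting (the X^alg / X^trans dichotomy of Pila–Wilkie transported from rational
points to sheets of the complex
logarithm) and functional transcendence (Ax) with elementary transcendence-degree bookkeeping; the
uniformity-in-V viewpoint is
Zilber2002's (USC) and Kirby–Zilber's (doi:10.1112/S0024609306018510, SC ⇒ USC over ℝ by
o-minimality). What it does that prior
routes do not: RigidCore localises a first counterexample into acl(∅) by symmetry and needs
FINITENESS at n = 2; DiophantineDichotomy
and RoyCriterion attack fixed Khovanskii points by approximation exponents; this line proves that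
the counterexample cannot sit in a
moving family at all (MovingDescent), names the two rigid residues by their sheet geometry, and
supplies the only unconditional
density statement about the transcendental residue (TransPartSparse); negatives index empty at
filing.

RANKED CRUXES. #2 SlidingRigidity (crux) — Schanuel in all ranks r < n ⇒ a ℚ-linearly independent x
∈ ℂⁿ with trdeg ℚ(x, eˣ) < n admits NO SLIDING deformation inside its ℚ-locus: no real-algebraic
sheet path a and analytic witness path ξ with (ξ + 2πi a, e^ξ) in the locus, (a, ξ)(0⁺) = (0, x),
and a ℤ-combination q with q·ξ constant but q·a non-constant. Structure known now: Ax expels the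
moving block unless the frozen block u₀ (m = n − r ≥ 2 independent coordinates) has trdeg ℚ(e^(u₀))
≤ m − 2; the pure case r = 0 is "x independent, trdeg ℚ(eˣ) ≤ n − 2, locus ruled through (x, eˣ) by
x + 2πi·(real algebraic arc)"; at n = 2 this is eˣ ∈ ℚ̄² unimodular (support SlidingTwoUnimodular):
two ℚ-independent arguments of unimodular algebraic numbers lying on a real ℚ̄-curve. [difficulty:
open-problem] (why it might fail: At n = 2 it contains "π ⊥ arg((3+4i)/5)" and algebraic
independence of two unimodular logarithms — the unitary-axis atom where ModulusFirst stalled; Baker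
kills only the LINE configurations, and no linear-forms method handles ℚ̄-curves of degree ≥ 2.)
[BakerTNT1975, Waldschmidt2000, DaquinoMacintyreTerzo2014, Ax1971, Lang1966, Zilber2002]
#3 TransPartRigidity (crux) — Schanuel in all ranks r < n ⇒ a ℚ-linearly independent x ∈ ℂⁿ with
trdeg ℚ(x, eˣ) < n is never transcendentally placed: it admits a MOVING or a SLIDING deformation
inside its ℚ-locus (it lies in the algebraic part of its sheet family). Given MovingDescent and
SlidingRigidity this is equivalent to Schanuel at rank n; the class it empties contains (1, πi) (e ⊥
π — transcendental placement checked from Lindemann alone), (log 2, log 3), (πi, log 2), (1, e); by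
o-minimality it is where a first counterexample of a dimension-d locus is EXPECTED (real dimension
of the sheet family 2d − n ≤ n − 2 < n), and TransPartSparse bounds its members on any fixed variety
by c (log H)^κ in imaginary height H. [difficulty: open-problem] (why it might fail: It is the
arithmetic core: e ⊥ π and log 2 ⊥ log 3 are transcendentally placed; counting saturates at (log
H)^κ (BNZ) and exp has no Galois-orbit lower bound — the second leg of every Pila–Zannier argument
is missing, so nothing known turns polylog into zero.) [BinyaminiNovikovZak2024, arXiv:2202.05305,
PilaWilkie2006, Pila2022, Kirby2010EAEF, Waldschmidt2000]
#4 MovingDescent (crux) — Schanuel in all ranks r < n ⇒ a ℚ-linearly independent x ∈ ℂⁿ with trdeg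
ℚ(x, eˣ) = d < n admits no MOVING deformation inside its ℚ-locus (the route's engine; provable now).
Plan: Λ = {q ∈ ℤⁿ : q·ξ constant on (0, ε)} is saturated, r = n − rk Λ; r = 0 contradicts
non-triviality (continuity at 0⁺ forces a ≡ 0, ξ ≡ x); u₀ = Q_Λ x is ℚ-independent, so Schanuel in
rank n − r gives trdeg ℚ(u₀, e^(u₀)) ≥ n − r (r ≥ 1); the u-coordinates of P(s) equal those of P₀
(moving condition + continuity), so ℚ[P₀] ↠ ℚ[P(·)] is a specialisation over F₀ = ℚ(u₀, e^(u₀)) and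
trdeg_ℂ ℂ(P(·)) ≤ d − (n − r) ≤ r − 1; each aᵢ is algebraic over ℂ(s) (cost ≤ 1), so ℂ(ξ_v, e^(ξ_v))
⊆ ℂ(a, P) has trdeg ≤ r, against Ax's ≥ r + 1 (r = n: n + 1 ≤ d + 1 ≤ n). Pure transcendence-degree
bookkeeping + `Literature.NumberTheory.Transcendental.ax_schanuel_holds` with K = germs of
real-analytic functions, D = d/ds. [difficulty: L] (why it might fail: The margin is exactly zero
(the real-algebraic sheet path costs one transcendence degree): any slack in the inlined arc
conditions (analytic only on (0, ε), one-sided continuity at 0, coordinatewise algebraic a) or in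
instantiating the tree's derivation-form Ax on analytic germs breaks it.) [Ax1971, Kirby2010EAEF,
BaysKirbyWilkie2010, Marker2006, Kirby2009]
#9 SlidingTwoUnimodular (support) — n = 2 structure theorem, provable now: a sliding deformation of
a first counterexample x ∈ ℂ² forces e^(x₁), e^(x₂) algebraic of modulus 1. Proof plan: r = 1 is
impossible (q·x(s) = c + 2πi q·a(s) is a non-constant algebraic function in ℂ(P(·)), which has
trdeg_ℂ ≤ 1, so every coordinate of P(s) — in particular ξ_v and e^(ξ_v) — is algebraic over ℂ(s),
against Ax); r = 0 gives ξ ≡ x and y ≡ eˣ along P(s), so the ℚ(eˣ)-specialisation forces trdeg ℚ(eˣ)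
= 0; the component of the locus slice through x is C = x + 2πi D_ℂ with D real, hence C = 2 Re x −
conj(C) with C, conj(C) irreducible ℚ̄-curves; C a line {β·X = γ} over ℚ̄ contradicts Baker (tree
`baker_holds`: 1, x₁, x₂ are ℚ̄-independent); otherwise the translation-transporter is one ℚ̄-point,
Re x ∈ ℚ̄², and Hermite–Lindemann (tree `transcendental_exp_holds`, |e^(xᵢ)| = e^(Re xᵢ) algebraic)
gives Re x = 0. Lands SlidingRigidity at n = 2 on the unitary axis shared with RigidCore's
SparsityTwo (stmt-Schanuel-0971). [difficulty: provable-now] [BakerTNT1975, Lindemann1882, Ax1971,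
Literature.NumberTheory.Transcendental.baker_holds,
Literature.NumberTheory.Transcendental.transcendental_exp_holds]
#9 TransPartSparse (support) — the card's theorem in point form, modulo BNZ: for every
Zariski-closed V ⊆ ℂⁿ × ℂⁿ there are c, κ such that for H ≥ 3 the graph points (x, eˣ) ∈ V with ‖Im
x‖_∞ ≤ H admitting NO sheet deformation inside V (neither moving nor sliding: transcendentally
placed in the sheet family of V) number ≤ c (log H)^κ. Proof plan: Y = {(a, u, θ) : P_j(u + iθ + 2πi
a, e^u(cos θ + i sin θ)) = 0, θ ∈ [0, 2π)} truncated at |u| ≤ M is restricted semi-Pfaffian of (F,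
D) independent of M (BNZ Cor 1's device); sharp cell decomposition; a transcendentally placed point
on sheet k ∈ ℤⁿ lies in a cell C with finite fibres over π(C), and k ∈ π(C)^alg would give, by
definable triviality of C over a Nash arc through k, a deformation — so k ∈ π(C)^trans, counted by
BNZ Thm 1 uniformly over the poly_F(D) cells; finiteness of the set from o-minimality. Calibration:
a square system carries ≍ H graph points of imaginary height ≤ H, all moving (implicit function
theorem); Schanuel predicts 0 transcendentally placed counterexamples. [difficulty: XL]
[BinyaminiNovikovZak2024, arXiv:2202.05305, PilaWilkie2006, Pila2022, Wilkie1996, Khovanskii1991,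
BochnakCosteRoy1998]

TWO-LAYER PLAN. Foreseen glued splits (none filed now; k ≤ 3, depth 1). SlidingRigidity ⇐
SlidingStructure (Ax on the moving block: a sliding
deformation of a first counterexample has a frozen block u₀, m = n − r ≥ 2, with trdeg ℚ(e^(u₀)) ≤ m
− 2 and a ruled locus slice —
provable like MovingDescent) → RuledLocusRigidity (no first counterexample whose locus slice at
fixed y^q is ruled by a translate of a
real-algebraic arc: the Baker-type core; n = 2 = the unitary two-argument atom) → SlidingRigidity.
TransPartRigidity ⇐ IsolatedSheets
(isolated points of the sheet family, the expected case 2d ≤ n) → TranscendentalArcs (2d > n) →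
TransPartRigidity. MovingDescent ⇐
SpecialisationLemma (trdeg does not increase along ℚ[P₀] ↠ ℚ[P(·)] over the frozen field) →
AxOnGerms (tree ax_schanuel instantiated
on real-analytic germs with D = d/ds, constants = ℂ) → MovingDescent.

KILL CRITERIA. MovingDescent refuted (a moving deformation compatible with Schanuel below rank n —
necessarily through a leak in the zero-margin
count or in the inlined arc conditions) ⇒ the trichotomy leaks: restate with the leaking family as a
fourth class if it is
visibly lower-rank, else close `refuted:MovingDescent` (the line's one theorem was wrong).
SlidingRigidity and TransPartRigidity are
implied by Schanuel and cannot be refuted without refuting the summit; the route is closed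
`superseded` if RigidCore's
MinimalCounterexampleInAcl absorbs both residues with a proof that does not pass through sheet
geometry, and its n = 2 layer is mooted
by SchanuelTwo (stmt-Schanuel-0069). SlidingTwoUnimodular refuted (a sliding configuration at n = 2
off the unit circle, e.g. through
a transporter with positive-dimensional stabiliser I mis-analysed) ⇒ SlidingRigidity's n = 2 content
is larger than the unitary atom;
re-derive, the route stands. TransPartSparse refuted (a closed V with ≫ (log H)^κ deformation-free
graph points of height ≤ H) = the
format-uniformity-in-M claim is false: restate with H^ε (PilaWilkie2006 needs no format), grade
drops, deciding chain unaffected.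

NOT DECOMPOSED YET. The n ≥ 3 anatomy of sliding configurations (partially frozen witnesses, ruled
loci, which Baker-type statement each needs) — layer 2
after SlidingStructure. BNZ Thm 1 / Cor 1 as a Literature cite fact over a minimal
restricted-sub-Pfaffian vocabulary and the format
lemma, cell decomposition / definable triviality / curve selection for (ℝ, exp, sin|[0,2π]) behind
TransPartSparse (no ℝ_an,exp
o-minimality in tree). Explicit κ (Pila 2007 doi:10.5802/afst.1162 for Pfaff curves; effective
Pfaffian Pila–Wilkie arXiv:2301.09883).
The dictionary item SchanuelIffSheets and the window bookkeeping of the retired route (not needed: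
the deciding chain speaks of the
point and its ℚ-locus, MvPolynomial-inlined, no zariskiDim). The card's DAO(i)–(iii) and
FixedPointPairsDiagonal (zero sets of
one-variable exponential polynomials are n = 1 configurations, all MOVING by the implicit function
theorem, hence outside the deciding
chain; DAO(ii) stays a lemma for card tight-tuples-relative-hl-fixed-points). The certified
enumeration N1 of the retired route
(sheets of the unitary-symmetric benchmark curve up to 10⁶) — evidence for refuters, attachable to
SlidingRigidity. Definition items
`sheetDeformation` / `IsMoving` / `IsSliding` under Summits/Schanuel/Schanuel/Theorems to replace
the inlined blocks once a prover asks.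

CHEAPEST FALSIFIER. (1) A grounder re-derives MovingDescent by hand at n = 1 (d = 0: the locus is
finite, a deformation in it is constant, continuity at
0⁺ makes it trivial) and at n = 2 (r = 1, 2), and checks the zero-margin chain r + 1 ≤ trdeg_ℂ
ℂ(ξ_v, e^(ξ_v)) ≤ 1 + (d − (n − r)) ≤ r
against the inlined arc conditions (analytic aᵢ with a nonzero relation p(s, aᵢ(s)) = 0 on an
interval ⇒ trdeg_ℂ ℂ(a) ≤ 1). One
afternoon; a NO kills the line. (2) Transcendental placement of (1, πi): the sheet family of the
locus {X₁ = 1, Y₂ = −1, G(X₂, Y₁) = 0}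
is cut by two real equations in (a₁, a₂) and is (by Lindemann) 0-dimensional at a = 0; were e ⊥ π a
SLIDING configuration, the
advertised content of the two residues is wrong (route survives, thesis text does not). (3)
Literature: a printed "Ax–Schanuel ⇒
counterexamples to SC are rigid in real-translated families" lemma would make MovingDescent `known`
— searched (Pila2022 Ch. 13/18 READ,
Kirby–Zilber 2006, Kirby2010EAEF Prop 7.2: nearest, not the same statement; hybrid/galaxy queries in
Novelty): none found.

NUMBERS. Real dimension of the sheet family of a locus of dimension d: expected 3n − 2(2n − d) = 2d
− n (n = 2, d = 1: isolated sheets;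
n = 3, d = 2: arcs, generically transcendental). BNZ Thm 1: #X^trans(g, H) ≤ poly_F(D, g, log H),
exponent unspecified; Pila AIF 60
(2010) doi:10.5802/aif.2530: (log T)^(44+ε) for log x log y = log z; Pila 2007
doi:10.5802/afst.1162: explicit (log H)^γ for Pfaff
curves. Square (Khovanskii) systems at n = 2 carry ≍ H graph points of imaginary height ≤ H (one per
period strip per
branch), all moving. MovingDescent margin: 0 (r + 1 vs r); in the fibre-arc sub-case (a ≡ 0) margin
1. Items at open: 6 (3
cruxes, 2 supports, 1 assembly).

DEFINITION REQUESTS. None filed at open (everything inlined over Mathlib: MvPolynomial.aeval for the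
ℚ-locus, AnalyticOnNhd ℝ, ContinuousWithinAt,
MvPolynomial (Fin 2) ℝ for real-algebraic sheet paths; Zariski-closedness of V in TransPartSparse as
its Mathlib definiens `∃ I : Ideal (MvPolynomial (Fin n ⊕ Fin n) ℂ), V = MvPolynomial.zeroLocus ℂ I`
— rev 1 cone repair: was `Literature.NumberTheory.Transcendental.IsZariskiClosed ℂ V`,
definitionally equal (Iff.rfl), inlined so that the route file imports nothing beyond the gate
defaults and its module cone equals the Statement's). CONE FACTS (route-repair 2026-08-15,
needs-fact: none): the 12 unproved closed Props of the import cone — nesterenko, nesterenko' and the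
ten @[conjecture] defs of Literature/NumberTheory/Transcendental/PeriodsWave0.lean — enter only
through the operator-owned import Summits.Schanuel.Statement → Summits.Schanuel.Schanuel.Statement →
PeriodsWave0 and are named by no item and by no hypothesis of `closes` (decl cone rev 1: 9 project
constants, 0 unproved).
Foreseen: definition items `sheetDeformation`, `IsMovingDeformation`, `IsSlidingDeformation` (topic
Summits/Schanuel/Schanuel/Theorems)
and a cite item "fact: BinyaminiNovikovZak2024 Thm 1 + Cor 1 (Wilkie's conjecture for restricted
sub-Pfaffian sets and ℝ_exp)" under
Literature/ModelTheory/ExponentialFields as the landing place of TransPartSparse's split.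

Novelty: Searches (2026-08-15, this planner): `lit read arXiv:2202.05305 --grep Corollary|Theorem
1|restricted` (p.3 READ: Thm 1, Cor 1 +
M-truncation proof, Thm 2 blocks; §1.3.2 ℝ^RE); `lit search --hybrid "Ax-Schanuel counterexample
Schanuel conjecture deformation real
analytic family exponential variety lower rank reduction" --no-graph` (10 docs; Pila2022 pp. 48,
96–97, 124–125, 182 READ: §13 SC and
Ax–Schanuel, Conj. 18.13 USC, Thm 18.14 "ZP ⇒ (SC ⇒ USC)", "over ℝ SC ⇒ USC [Kirby–Zilber 2006]");
`lit galaxy search "uniform Schanuel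
conjecture" --star all` (2 rows: Pila2022, Jones–Wilkie (eds) O-minimality and Diophantine
Geometry); `lit galaxy search "Schanuel
conjecture" --star pdf` (11 rows: Bombieri–Masser–Zannier, Bainbridge–Habegger–Möller
arXiv:1410.6835 just-likely intersections in
𝔾_mⁿ × 𝔾_aⁿ, Kirby2009, Ghioca–Nguyen dynamical Pink–Zilber — none deforms Schanuel counterexamples
along sheets); `lit galaxy search
"uniform Schanuel conjecture over the real numbers o-minimal" --star all` (0); `lit search`
Habegger–Pila semi-rational counting (searchd
rc 75, down); ledger negatives (0); the 17 open Schanuel route headers (none uses o-minimal counting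
or sheet deformations; RigidCore's
S* is the nearest in spirit); plus the card's and the retired route's logged searches (frontier rows
arXiv:2301.09883, arXiv:2604.15189;
Pila AIF 2010; zbMATH reads of the genre Jones–Thomas–Wilkie / Boxall–Jones / Masser).
Nearest prior art found: Zilber2002 + Kirby–Zilber doi:10.1112/S002460930  [refs: 10.1112/S0024609306018510, 10.5802/aif.2530, 2202.05305, 1410.6835, 2301.09883, 2604.15189, doi:10.1112/S0024609306018510, doi:10.5802/aif.2530, Pila2022, Kirby2009, Zilber2002, BaysKirbyWilkie2010, BinyaminiNovikovZak2024]

Barriers (technique_class: o-minimal-counting, ax-schanuel, wilkie-conjecture): - technique_class: o-minimal-counting, ax-schanuel, wilkie-conjecture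
- Literature.Barriers.Schanuel.AxSchanuelFunctionalNotNumerical: respected and used at full
strength, not evaded — Ax acts only on genuine one-parameter families (MovingDescent, the moving
block of sliding deformations); the numerical content is quarantined, by a theorem rather than by
fiat, in SlidingRigidity ∪ TransPartRigidity, about which the route claims no instance; the bet is
that knowing a first counterexample is sheet-rigid (no moving family) and, if transcendentally
placed, polylog-sparse is the most one can prove unconditionally today and is worth having
kernel-checked.
- Literature.Barriers.Schanuel.AlgebraicIndependenceOfLogarithms: it does not evade it —
SlidingRigidity at n = 2 IS algebraic independence of two unimodular logarithms on ℚ̄-curves and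
TransPartRigidity contains log 2 ⊥ log 3; the route only sorts the conjecture's instances by sheet
geometry (line configurations die by Baker at proved strength inside SlidingTwoUnimodular).
- Literature.Barriers.Schanuel.LinearSubgroupMethodLimit: applies to any attack on SlidingRigidity's
curved configurations (degree ≥ 2 ruled loci are beyond linear algebraic groups); not evaded;
recorded as the reason SlidingRigidity is rank 2.
- Literature.Barriers.Schanuel.LargeTranscendenceDegree: other technique class (no auxiliary
functions); n/a — though the expected-dimension count 2d − n of the sheet family singles out the
same threshold d ≈ n/2 as the

History (route lifecycle, newest last):
- 2026-08-15T19:25:25Z · rev 1: restated TransPartSparse (stmt-Schanuel-13678) — route-repair (cone guardrail, gen 1; unit rrepair-Schanuel-SheetDescent-c335d8d1). needs-fact: NONE. The 12 unproved closed Props of the MODULE import cone are (planner-rrepair-Schanuel-SheetDescent-c335d8d1-0)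
- 2026-08-22T18:46:10Z · DORMANT — reconciler: no traction for 5.6 d (last activity item-evidence-added at 2026-08-17T04:24:25Z); parked, not closed — `ledger route dormant route-Schanuel-SheetDe (operator:999:1253127)

sub-problem: Schanuel · status: dormant · opened planner-plancard-Schanuel-Schanuel-sparse-she-6c39614c-g2-0 2026-08-15T19:02:42Z · rev 2 · ledger route-Schanuel-SheetDescent
GENERATED by the gate from the ledger (D-0016/17). Provers cite these decls: `theorem foo : Summit.Schanuel.Schanuel.Theses.SheetDescent.<Decl> := …` in Summits/Schanuel/Schanuel/Theorems/<Name>.lean.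
-/

namespace Summit.Schanuel.Schanuel.Theses.SheetDescent

open scoped BigOperators Topology Manifold Classical MeasureTheory ProbabilityTheory Matrix InnerProductSpace ComplexConjugate ContinuousMap
open Filter Set Function TopologicalSpace MeasureTheory

attribute [summit_statement] _root_.Schanuel

open Literature.Periods

/-- item stmt-Schanuel-13674 · crux · rank 2 · open · by planner
why it might fail: At n = 2 it contains "π ⊥ arg((3+4i)/5)" and algebraic independence of two unimodular logarithms — the unitary-axis atom where ModulusFirst stalled; Baker kills only the LINE configurations, and no linear-forms method handles ℚ̄-curves of degree ≥ 2.
sources: BakerTNT1975, Waldschmidt2000, DaquinoMacintyreTerzo2014, Ax1971, Lang1966, Zilber2002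
[crux] Schanuel in all ranks r < n ⇒ a ℚ-linearly independent x ∈ ℂⁿ with trdeg ℚ(x, eˣ) < n admits
NO SLIDING deformation inside its ℚ-locus: no real-algebraic sheet path a and analytic witness path
ξ with (ξ + 2πi a, e^ξ) in the locus, (a, ξ)(0⁺) = (0, x), and a ℤ-combination q with q·ξ constant
but q·a non-constant. Structure known now: Ax expels the moving block unless the frozen block u₀ (m
= n − r ≥ 2 independent coordinates) has trdeg ℚ(e^(u₀)) ≤ m − 2; the pure case r = 0 is "x
independent, trdeg ℚ(eˣ) ≤ n − 2, locus ruled through (x, eˣ) by x + 2πi·(real algebraic arc)"; at n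
= 2 this is eˣ ∈ ℚ̄² unimodular (support SlidingTwoUnimodular): two ℚ-independent arguments of
unimodular algebraic numbers lying on a real ℚ̄-curve. [difficulty: open-problem] -/
@[route_item "route-Schanuel-SheetDescent", crux]
def SlidingRigidity : Prop :=
  ∀ (n : ℕ), (∀ r < n, ∀ y : Fin r → ℂ, LinearIndependent ℚ y → (r : Cardinal) ≤ Algebra.trdeg ℚ ↥(IntermediateField.adjoin ℚ (Set.range y ∪ Set.range (Complex.exp ∘ y)))) → ∀ x : Fin n → ℂ, LinearIndependent ℚ x → Algebra.trdeg ℚ ↥(IntermediateField.adjoin ℚ (Set.range x ∪ Set.range (Complex.exp ∘ x))) < (n : Cardinal) → ¬ (∃ (a : ℝ → Fin n → ℝ) (ξ : ℝ → Fin n → ℂ) (ε : ℝ), (0 < ε ∧ a 0 = 0 ∧ ξ 0 = x ∧ ContinuousWithinAt a (Set.Ici 0) 0 ∧ ContinuousWithinAt ξ (Set.Ici 0) 0 ∧ AnalyticOnNhd ℝ a (Set.Ioo 0 ε) ∧ AnalyticOnNhd ℝ ξ (Set.Ioo 0 ε) ∧ (∀ i, ∃ p : MvPolynomial (Fin 2)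 ℝ, p ≠ 0 ∧ ∀ s ∈ Set.Ioo 0 ε, MvPolynomial.eval ![s, a s i] p = 0) ∧ (∀ s ∈ Set.Ioo 0 ε, ∀ f : MvPolynomial (Fin n ⊕ Fin n) ℚ, MvPolynomial.aeval (Sum.elim x (Complex.exp ∘ x)) f = 0 → MvPolynomial.aeval (Sum.elim (fun i => ξ s i + 2 * (Real.pi : ℂ) * Complex.I * ((a s i : ℝ) : ℂ)) (fun i => Complex.exp (ξ s i))) f = 0)) ∧ (∃ q : Fin n → ℤ, (∃ c : ℂ, ∀ s ∈ Set.Ioo 0 ε, ∑ i, (q i : ℂ) * ξ s i = c) ∧ ¬ (∃ c : ℝ, ∀ s ∈ Set.Ioo 0 ε, ∑ i, (q i : ℝ) * a s i = c)))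

/-- item stmt-Schanuel-13675 · crux · rank 3 · open · by planner
why it might fail: It is the arithmetic core: e ⊥ π and log 2 ⊥ log 3 are transcendentally placed; counting saturates at (log H)^κ (BNZ) and exp has no Galois-orbit lower bound — the second leg of every Pila–Zannier argument is missing, so nothing known turns polylog into zero.
sources: BinyaminiNovikovZak2024, arXiv:2202.05305, PilaWilkie2006, Pila2022, Kirby2010EAEF, Waldschmidt2000
[crux] Schanuel in all ranks r < n ⇒ a ℚ-linearly independent x ∈ ℂⁿ with trdeg ℚ(x, eˣ) < n is
never transcendentally placed: it admits a MOVING or a SLIDING deformation inside its ℚ-locus (it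
lies in the algebraic part of its sheet family). Given MovingDescent and SlidingRigidity this is
equivalent to Schanuel at rank n; the class it empties contains (1, πi) (e ⊥ π — transcendental
placement checked from Lindemann alone), (log 2, log 3), (πi, log 2), (1, e); by o-minimality it is
where a first counterexample of a dimension-d locus is EXPECTED (real dimension of the sheet family
2d − n ≤ n − 2 < n), and TransPartSparse bounds its members on any fixed variety by c (log H)^κ in
imaginary height H. [difficulty: open-problem] -/
@[route_item "route-Schanuel-SheetDescent", crux]
def TransPartRigidity : Prop :=
  ∀ (n : ℕ), (∀ r < n, ∀ y : Fin r → ℂ, LinearIndependent ℚ y → (r : Cardinal) ≤ Algebra.trdeg ℚ ↥(IntermediateField.adjoin ℚ (Set.range y ∪ Set.range (Complex.exp ∘ y)))) → ∀ x : Fin n → ℂ, LinearIndependent ℚ x → Algebra.trdeg ℚ ↥(IntermediateField.adjoin ℚ (Set.range x ∪ Set.range (Complex.exp ∘ x))) < (n : Cardinal) → (∃ (a : ℝ → Fin n → ℝ) (ξ : ℝ → Fin n → ℂ) (ε : ℝ), (0 < ε ∧ a 0 = 0 ∧ ξ 0 = x ∧ ContinuousWithinAt a (Set.Ici 0) 0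 ∧ ContinuousWithinAt ξ (Set.Ici 0) 0 ∧ AnalyticOnNhd ℝ a (Set.Ioo 0 ε) ∧ AnalyticOnNhd ℝ ξ (Set.Ioo 0 ε) ∧ (∀ i, ∃ p : MvPolynomial (Fin 2) ℝ, p ≠ 0 ∧ ∀ s ∈ Set.Ioo 0 ε, MvPolynomial.eval ![s, a s i] p = 0) ∧ (∀ s ∈ Set.Ioo 0 ε, ∀ f : MvPolynomial (Fin n ⊕ Fin n) ℚ, MvPolynomial.aeval (Sum.elim x (Complex.exp ∘ x)) f = 0 → MvPolynomial.aeval (Sum.elim (fun i => ξ s i + 2 * (Real.pi : ℂ) * Complex.I * ((a s i : ℝ) : ℂ)) (fun i => Complex.exp (ξ s i))) f = 0)) ∧ (∃ s ∈ Set.Ioo 0 ε, a s ≠ 0 ∨ ξ s ≠ x) ∧ (∀ q : Fin n → ℤ, (∃ c : ℂ, ∀ s ∈ Set.Ioo 0 ε, ∑ i, (q i : ℂ) * ξ s i = c) → (∃ c : ℝ, ∀ s ∈ Set.Ioo 0 ε, ∑ i, (q i : ℝ) * a s i = c))) ∨ (∃ (a : ℝ → Fin n → ℝ) (ξ : ℝ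 → Fin n → ℂ) (ε : ℝ), (0 < ε ∧ a 0 = 0 ∧ ξ 0 = x ∧ ContinuousWithinAt a (Set.Ici 0) 0 ∧ ContinuousWithinAt ξ (Set.Ici 0) 0 ∧ AnalyticOnNhd ℝ a (Set.Ioo 0 ε) ∧ AnalyticOnNhd ℝ ξ (Set.Ioo 0 ε) ∧ (∀ i, ∃ p : MvPolynomial (Fin 2) ℝ, p ≠ 0 ∧ ∀ s ∈ Set.Ioo 0 ε, MvPolynomial.eval ![s, a s i] p = 0) ∧ (∀ s ∈ Set.Ioo 0 ε, ∀ f : MvPolynomial (Fin n ⊕ Fin n) ℚ, MvPolynomial.aeval (Sum.elim x (Complex.exp ∘ x)) f = 0 → MvPolynomial.aeval (Sum.elim (fun i => ξ s i + 2 * (Real.pi : ℂ) * Complex.I * ((a s i : ℝ) : ℂ)) (fun i => Complex.exp (ξ s i))) f = 0)) ∧ (∃ q : Fin n → ℤ, (∃ c : ℂ, ∀ s ∈ Set.Ioo 0 ε, ∑ i, (q i : ℂ) * ξ s i = c) ∧ ¬ (∃ c : ℝ, ∀ s ∈ Set.Ioo 0 ε, ∑ i, (q i : ℝ) * a s i =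 c)))

/-- item stmt-Schanuel-13676 · crux · rank 4 · open · by planner
why it might fail: The margin is exactly zero (the real-algebraic sheet path costs one transcendence degree): any slack in the inlined arc conditions (analytic only on (0, ε), one-sided continuity at 0, coordinatewise algebraic a) or in instantiating the tree's derivation-form Ax on analytic germs breaks it.
sources: Ax1971, Kirby2010EAEF, BaysKirbyWilkie2010, Marker2006, Kirby2009
[crux] Schanuel in all ranks r < n ⇒ a ℚ-linearly independent x ∈ ℂⁿ with trdeg ℚ(x, eˣ) = d < n
admits no MOVING deformation inside its ℚ-locus (the route's engine; provable now). Plan: Λ = {q ∈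
ℤⁿ : q·ξ constant on (0, ε)} is saturated, r = n − rk Λ; r = 0 contradicts non-triviality
(continuity at 0⁺ forces a ≡ 0, ξ ≡ x); u₀ = Q_Λ x is ℚ-independent, so Schanuel in rank n − r gives
trdeg ℚ(u₀, e^(u₀)) ≥ n − r (r ≥ 1); the u-coordinates of P(s) equal those of P₀ (moving condition +
continuity), so ℚ[P₀] ↠ ℚ[P(·)] is a specialisation over F₀ = ℚ(u₀, e^(u₀)) and trdeg_ℂ ℂ(P(·)) ≤ d
− (n − r) ≤ r − 1; each aᵢ is algebraic over ℂ(s) (cost ≤ 1), so ℂ(ξ_v, e^(ξ_v)) ⊆ ℂ(a, P) has trdeg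
≤ r, against Ax's ≥ r + 1 (r = n: n + 1 ≤ d + 1 ≤ n). Pure transcendence-degree bookkeeping +
`Literature.NumberTheory.Transcendental.ax_schanuel_holds` with K = germs of real-analytic
functions, D = d/ds. [difficulty: L] -/
@[route_item "route-Schanuel-SheetDescent", crux]
def MovingDescent : Prop :=
  ∀ (n : ℕ), (∀ r < n, ∀ y : Fin r → ℂ, LinearIndependent ℚ y → (r : Cardinal) ≤ Algebra.trdeg ℚ ↥(IntermediateField.adjoin ℚ (Set.range y ∪ Set.range (Complex.exp ∘ y)))) → ∀ x : Fin n → ℂ, LinearIndependent ℚ x → Algebra.trdeg ℚ ↥(IntermediateField.adjoin ℚ (Set.range x ∪ Set.range (Complex.exp ∘ x))) < (n : Cardinal) → ¬ (∃ (a : ℝ → Fin n → ℝ) (ξ : ℝ → Fin n → ℂ) (ε : ℝ), (0 < ε ∧ a 0 = 0 ∧ ξ 0 = x ∧ ContinuousWithinAt a (Set.Ici 0) 0 ∧ ContinuousWithinAt ξ (Set.Ici 0) 0 ∧ AnalyticOnNhd ℝ a (Set.Ioo 0 ε) ∧ AnalyticOnNhd ℝ ξ (Set.Ioo 0 ε)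 ∧ (∀ i, ∃ p : MvPolynomial (Fin 2) ℝ, p ≠ 0 ∧ ∀ s ∈ Set.Ioo 0 ε, MvPolynomial.eval ![s, a s i] p = 0) ∧ (∀ s ∈ Set.Ioo 0 ε, ∀ f : MvPolynomial (Fin n ⊕ Fin n) ℚ, MvPolynomial.aeval (Sum.elim x (Complex.exp ∘ x)) f = 0 → MvPolynomial.aeval (Sum.elim (fun i => ξ s i + 2 * (Real.pi : ℂ) * Complex.I * ((a s i : ℝ) : ℂ)) (fun i => Complex.exp (ξ s i))) f = 0)) ∧ (∃ s ∈ Set.Ioo 0 ε, a s ≠ 0 ∨ ξ s ≠ x) ∧ (∀ q : Fin n → ℤ, (∃ c : ℂ, ∀ s ∈ Set.Ioo 0 ε, ∑ i, (q i : ℂ) * ξ s i = c) → (∃ c : ℝ, ∀ s ∈ Set.Ioo 0 ε, ∑ i, (q i : ℝ) * a s i = c)))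

-- earlier TransPartSparse (stmt-Schanuel-13678, replaced 2026-08-15T19:25:25Z -> stmt-Schanuel-13588): retired by None — ∀ (n : ℕ) (V : Set (Fin n ⊕ Fin n → ℂ)), Literature.NumberTheory.Transcendental.IsZariskiClosed ℂ V → ∃ (c : ℝ) (κ : ℕ), ∀ H : ℕ, 3 ≤ H → ∃ S : Finset (Fin n → ℂ), (S.card : ℝ) ≤ c * Real.log H ^ κ ∧ ∀ x : Fin n → ℂ, Sum.elim x (Complex.exp ∘ x) ∈ V → (∀ i, |(x i).im| ≤ H) → ¬ (∃ 
/-- item stmt-Schanuel-13588 · support · rank 9 · open · by planner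
sources: BinyaminiNovikovZak2024, arXiv:2202.05305, PilaWilkie2006, Pila2022, Wilkie1996, Khovanskii1991
[support] the card's theorem in point form, modulo BNZ: for every Zariski-closed V ⊆ ℂⁿ × ℂⁿ there
are c, κ such that for H ≥ 3 the graph points (x, eˣ) ∈ V with ‖Im x‖_∞ ≤ H admitting NO sheet
deformation inside V (neither moving nor sliding: transcendentally placed in the sheet family of V)
number ≤ c (log H)^κ. Proof plan: Y = {(a, u, θ) : P_j(u + iθ + 2πi a, e^u(cos θ + i sin θ)) = 0, θ
∈ [0, 2π)} truncated at |u| ≤ M is restricted semi-Pfaffian of (F, D) independent of M (BNZ Cor 1's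
device); sharp cell decomposition; a transcendentally placed point on sheet k ∈ ℤⁿ lies in a cell C
with finite fibres over π(C), and k ∈ π(C)^alg would give, by definable triviality of C over a Nash
arc through k, a deformation — so k ∈ π(C)^trans, counted by BNZ Thm 1 uniformly over the poly_F(D)
cells; finiteness of the set from o-minimality. Calibration: a square system carries ≍ H graph
points of imaginary height ≤ H, all moving (implicit function theorem); Schanuel predicts 0
transcendentally placed counterexamples. [difficulty: XL] -/
@[route_item "route-Schanuel-SheetDescent"]
def TransPartSparse : Prop :=
  ∀ (n : ℕ) (V : Set (Fin n ⊕ Fin n → ℂ)), (∃ I : Ideal (MvPolynomial (Fin n ⊕ Fin n) ℂ), V = MvPolynomial.zeroLocus ℂ I) → ∃ (c : ℝ) (κ : ℕ), ∀ H : ℕ, 3 ≤ H → ∃ S : Finset (Fin n → ℂ), (S.card : ℝ) ≤ c * Real.log H ^ κ ∧ ∀ x : Fin n → ℂ, Sum.elim x (Complex.exp ∘ x) ∈ V → (∀ i, |(x i).im| ≤ H) → ¬ (∃ (a : ℝ → Fin n → ℝ) (ξ : ℝ → Fin n → ℂ) (ε : ℝ), (0 < ε ∧ a 0 = 0 ∧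 ξ 0 = x ∧ ContinuousWithinAt a (Set.Ici 0) 0 ∧ ContinuousWithinAt ξ (Set.Ici 0) 0 ∧ AnalyticOnNhd ℝ a (Set.Ioo 0 ε) ∧ AnalyticOnNhd ℝ ξ (Set.Ioo 0 ε) ∧ (∀ i, ∃ p : MvPolynomial (Fin 2) ℝ, p ≠ 0 ∧ ∀ s ∈ Set.Ioo 0 ε, MvPolynomial.eval ![s, a s i] p = 0) ∧ (∀ s ∈ Set.Ioo 0 ε, Sum.elim (fun i => ξ s i + 2 * (Real.pi : ℂ) * Complex.I * ((a s i : ℝ) : ℂ)) (fun i => Complex.exp (ξ s i)) ∈ V)) ∧ (∃ s ∈ Set.Ioo 0 ε, a s ≠ 0 ∨ ξ s ≠ x)) → x ∈ S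

/-- item stmt-Schanuel-13677 · support · rank 9 · open · by planner
sources: BakerTNT1975, Lindemann1882, Ax1971, Literature.NumberTheory.Transcendental.baker_holds, Literature.NumberTheory.Transcendental.transcendental_exp_holds
[support] n = 2 structure theorem, provable now: a sliding deformation of a first counterexample x ∈
ℂ² forces e^(x₁), e^(x₂) algebraic of modulus 1. Proof plan: r = 1 is impossible (q·x(s) = c + 2πi
q·a(s) is a non-constant algebraic function in ℂ(P(·)), which has trdeg_ℂ ≤ 1, so every coordinate
of P(s) — in particular ξ_v and e^(ξ_v) — is algebraic over ℂ(s), against Ax); r = 0 gives ξ ≡ x and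
y ≡ eˣ along P(s), so the ℚ(eˣ)-specialisation forces trdeg ℚ(eˣ) = 0; the component of the locus
slice through x is C = x + 2πi D_ℂ with D real, hence C = 2 Re x − conj(C) with C, conj(C)
irreducible ℚ̄-curves; C a line {β·X = γ} over ℚ̄ contradicts Baker (tree `baker_holds`: 1, x₁, x₂
are ℚ̄-independent); otherwise the translation-transporter is one ℚ̄-point, Re x ∈ ℚ̄², and
Hermite–Lindemann (tree `transcendental_exp_holds`, |e^(xᵢ)| = e^(Re xᵢ) algebraic) gives Re x = 0.
Lands SlidingRigidity at n = 2 on the unitary axis shared with RigidCore's SparsityTwo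
(stmt-Schanuel-0971). [difficulty: provable-now] -/
@[route_item "route-Schanuel-SheetDescent"]
def SlidingTwoUnimodular : Prop :=
  ∀ x : Fin 2 → ℂ, LinearIndependent ℚ x → Algebra.trdeg ℚ ↥(IntermediateField.adjoin ℚ (Set.range x ∪ Set.range (Complex.exp ∘ x))) < (2 : Cardinal) → (∃ (a : ℝ → Fin 2 → ℝ) (ξ : ℝ → Fin 2 → ℂ) (ε : ℝ), (0 < ε ∧ a 0 = 0 ∧ ξ 0 = x ∧ ContinuousWithinAt a (Set.Ici 0) 0 ∧ ContinuousWithinAt ξ (Set.Ici 0) 0 ∧ AnalyticOnNhd ℝ a (Set.Ioo 0 ε) ∧ AnalyticOnNhd ℝ ξ (Set.Ioo 0 ε) ∧ (∀ i, ∃ p : MvPolynomial (Fin 2) ℝ, p ≠ 0 ∧ ∀ s ∈ Set.Ioo 0 ε, MvPolynomial.eval ![s, a s i] p = 0) ∧ (∀ s ∈ Set.Ioo 0 ε, ∀ f : MvPolynomial (Fin 2 ⊕ Fin 2) ℚ, MvPolynomial.aeval (Sum.elim x (Complex.exp ∘ x)) f = 0 → MvPolynomial.aeval (Sum.elim (fun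 i => ξ s i + 2 * (Real.pi : ℂ) * Complex.I * ((a s i : ℝ) : ℂ)) (fun i => Complex.exp (ξ s i))) f = 0)) ∧ (∃ q : Fin 2 → ℤ, (∃ c : ℂ, ∀ s ∈ Set.Ioo 0 ε, ∑ i, (q i : ℂ) * ξ s i = c) ∧ ¬ (∃ c : ℝ, ∀ s ∈ Set.Ioo 0 ε, ∑ i, (q i : ℝ) * a s i = c))) → ∀ i, IsAlgebraic ℚ (Complex.exp (x i)) ∧ ‖Complex.exp (x i)‖ = 1

/-- item stmt-Schanuel-13679 · assembly · rank 1 · open · by planner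
sources: Ax1971, BinyaminiNovikovZak2024, Lang1966
[assembly] MovingDescent → SlidingRigidity → TransPartRigidity → Schanuel (strong induction on the
rank). -/
@[route_item "route-Schanuel-SheetDescent"]
def Assembly : Prop :=
  MovingDescent → SlidingRigidity → TransPartRigidity → _root_.Schanuel

/-! D-0027 §2.1 — DECIDING THEOREM (planner-authored via `route open/edit --closes-file`; by planner-plancard-Schanuel-Schanuel-sparse-she-6c39614c-g2-0 2026-08-15T19:02:42Z):
its hypotheses are this route's items and its conclusion the sub-problem Statement (glue_lint), and it elaborates with this file. -/

@[closes "route-Schanuel-SheetDescent"] theorem closes (hM : MovingDescent) (hL : SlidingRigidity) (hZ : TransPartRigidity) : _root_.Schanuel := by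
  show ∀ (n : ℕ) (z : Fin n → ℂ), LinearIndependent ℚ z →
    (n : Cardinal) ≤ Algebra.trdeg ℚ
      ↥(IntermediateField.adjoin ℚ (Set.range z ∪ Set.range (Complex.exp ∘ z)))
  intro n
  induction n using Nat.strong_induction_on with
  | _ n ih =>
    intro z hz
    by_contra hlt
    have hlt' : Algebra.trdeg ℚ
        ↥(IntermediateField.adjoin ℚ (Set.range z ∪ Set.range (Complex.exp ∘ z))) < (n : Cardinal) :=
      lt_of_not_ge hlt
    have hrank : ∀ r < n, ∀ y : Fin r → ℂ, LinearIndependent ℚ y → (r : Cardinal) ≤ Algebra.trdeg ℚ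
        ↥(IntermediateField.adjoin ℚ (Set.range y ∪ Set.range (Complex.exp ∘ y))) :=
      fun r hr => ih r hr
    rcases hZ n hrank z hz hlt' with hmov | hsl
    · exact hM n hrank z hz hlt' hmov
    · exact hL n hrank z hz hlt' hsl

end Summit.Schanuel.Schanuel.Theses.SheetDescent
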